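import Literature.MathematicalPhysics.QuantumFieldTheory.Balaban1983to89.B8Prop3SrcZd3
import Literature.MathematicalPhysics.QuantumFieldTheory.Balaban1983to89.B8LeafModelZd3H

/-!
# `Balaban1983to89.B8Prop3SrcZd3H` — [Balaban1985RegularSpaces] **PROPOSITION 3 WITH SOURCE** at the RE-TYPED carrier `B8LeafModelZd3H.zdGF3H`:
# this seat's g4 brick `B8Prop3SrcZd3.sp3src_zd3_map_of_sockB9P3src` (p495795) RE-RUN with the sourced b9 socket `SB9src` granted the repaired source
# premiss «`f ∈ R(U₀)` ∧ `f` Hermitian ∧ `f = 0` off Ω₀ ∧ `Bdd`» — the `SP3src` socket of `B8Thm8SurvivingZd3H.thm8SurvivingAt_zd3H_univ_lan` (p505395) in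
# `zdGF3H`'s own fields, from the primitive in-edge

statement-level skeleton of published theorems with citation tags; proofs where landed; nothing here is a claim about the Yang–Mills mass gap

T. Bałaban, *Spaces of regular gauge field configurations on a lattice and gauge fixing conditions*, Commun. Math. Phys. **99** (1985) 75–102
`[Balaban1985RegularSpaces]` ("B8"; journal page = PDF page + 74): Prop. 3 p. 87, (1.40)–(1.42) p. 83, (1.59)–(1.62) pp. 86–87, (1.36)–(1.39) p. 82,
Thm 8 (1.146) p. 101 («only some constants change»); [4] = T. Bałaban, *Propagators for lattice gauge theories in a background field*, CMP **99** (1985)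
389–434, Thm 3.3 p. 398.

## WHY THIS FILE (cell `pub-ymgap`, HUMAN RULING D-0062; R134 seat `pub-ymgap-dag-n05-c` g5, DAG node N05 = [B8]; count-neutral)

The H-chain (`B8LeafModelZd3H` p504278, `B8Thm8SurvivingZd3H` p505395, `B8LanF146` p504983) reduces Theorem 8's surviving form at the repaired carrier to five
sourced sockets, among them `SP3src` (Proposition 3 with source) stated in `zdGF3H`'s fields — whose `InR` is the four-clause membership.  The g4 brick
supplies `SP3src` at `zdGF3` from the sourced b9 socket `SB9src` whose source premiss is `InR138` alone; a provider of [4] Thm 3.3 with source may want the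
source Hermitian, supported on `Ω₀` and of finite norm.  THIS FILE is the same brick with BOTH ends in the repaired currency: `SB9srcH` = `SB9src` with the
three extra source hypotheses, conclusion = `SP3src` at `zdGF3H`.  Proof: the g4 proof VERBATIM, the socket fed `hInR.1`, `hInR.2.1`, `hInR.2.2.1`,
`hInR.2.2.2` (every estimate by name from `B8Prop3SrcZd3` §§1–2 and n05-b's ∕ n11-b's k-level files).

## HONEST SCOPE

A re-run; NO new estimate; the socket is a HYPOTHESIS per member `ι a`; count-neutral; N05 NOT discharged; `T_η ↦ ℤᵈ`; one finite `T⁴` programme at fixed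
`ε`, Bałaban as printed — nothing continuum ∕ ℝ⁴ ∕ OS ∕ mass-gap ∕ Clay.  No `sorry`, no definition, no `instance`.  Unit `pub-ymgap-dag-n05-c` (g5), 2026-08-27.

[cite: Balaban1985RegularSpaces, Prop. 3 p.87, (1.40)–(1.42) p.83, (1.59)–(1.62) pp.86–87, (1.36)–(1.39) p.82, Thm 8 (1.146) p.101; Balaban1985BackgroundPropagators, Thm 3.3 p.398]
-/
noncomputable section

open NormedSpace

namespace Literature.MathematicalPhysics.QuantumFieldTheory.Balaban1983to89.B8Prop3SrcZd3H

open Complex (I)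
open MatrixLog B7Prop1Explicit B7Prop2Explicit B7Prop1Local B7Eq92Concrete
open B7Prop2Explicit (C0 c2' unitaryUnits unitaryUnits_le_U1 avgClosed_unitaryUnits)
open B7Prop3Flat (c3)
open B7Prop4GeneralLevels (logCovIter linCovIter)
open B8Lemma1NonAbelian (mulCfg)
open B8Ineq132 (covDerivFwd InAk BondTouches)
open B8Eq146AExpansion (iEta expCfg plaqCovDeriv)
open B8Eq143PlaqExpansion (pdiv)
open B8Eq155JBound (Jcur wsup)
open B8Eq140Level (SideTouches)
open B8Eq184Proof (cfgExp)
open B8ScaledSupNorm (bondNorm msup weight Bdd)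
open B8Eq155KLevelLocal (eq155_norm_kLevel_hermitian)
open B8Eq156KLevelLocal (wsup_B1_le_kLevel)
open B8Prop3KLevel (bound_of_sideTouches)
open B8Eq138LandauZd (IsLandau146W InR138 logCfg covLap)
open B8Prop3GaugeFixedKLevel (inAk_congr_of_sideTouches expCfg_iEta_eq_cfgExp cfgExp_congr_at)
open B8LeafModelZd (ZdIdx)
open B8LeafModelZd3 (zdGF3 mlogCfg mlogCfg_of_sideTouches mlogCfg_of_not prop3_windows)
open B9Eq340HolderZd (hquot AdmPair)

-- `Site` alone could resolve to the torus sites of `Setup.lean`; re-export the `ℤ^d` sites of `B7Prop1Explicit`.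
export B7Prop1Explicit (Site)

variable {d : ℕ}
open B8LeafModelZd3H (zdGF3H)
open B8Prop3SrcZd3 (apriori_160_src4 apriori_160_fifth_src prop3_norms_kLevel_src4 prop3_fifth_kLevel_src)

section Zd3H

variable {𝔸 : Type} [CStarAlgebra 𝔸] [Nontrivial 𝔸]

/-- **PROPOSITION 3 WITH SOURCE at `zdGF3H`, from the sourced b9 socket in the repaired currency** (`sp3src_zd3_map_of_sockB9P3src` re-run): for any index
map `ι : J → ZdIdx d L`, if at each `ι a` [4] Thm 3.3 with source holds in Prop. 3's frame (`SB9srcH`: the five (1.59)-lines with source terms `+ γ″B₀(α₀+α₁)`,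
Hölder `+ γβ(α₀+α₁)`, for every source `f ∈ R(U₀)` that is HERMITIAN, vanishes off `Ω₀`, has `Bdd` and `|f|₍₋₂₎, |D f|₍₋₃₎ < γ(α₀+α₁)`), then `∃ c > 0` (member-free)
such that print's Prop.-3 sentence WITH SOURCE holds at `zdGF3H 𝔸 L β len (ι a)`: (1.40)–(1.42) + (1.146) + (1.61) ⇒ (1.36) ∧ (1.39) at `B₁ = 5dL·B₈`,
`B₂ = 5dL·B₈β`. [cite: Balaban1985RegularSpaces, Prop. 3 p.87, (1.40)–(1.42) p.83, (1.59)–(1.62) pp.86–87, (1.36)–(1.39) p.82, Thm 8 (1.146) p.101] -/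
theorem sp3src_zd3H_map_of_sockB9P3srcH (hd2 : 2 ≤ d) {L : ℕ} (hL : 2 ≤ L) {B₀ B₀β cP γ γ'' γβ B₈ B₈β : ℝ} (hB₀ : 0 < B₀) (hB₀β : 0 ≤ B₀β)
    (hcP : 0 < cP) (hγ'' : 0 ≤ γ'') (hB8 : 5 * (d : ℝ) * L * B₀ + 2 * (γ'' * B₀) ≤ 5 * (d : ℝ) * L * B₈)
    (hB8β : 5 * (d : ℝ) * L * B₀β + 2 * B₀β * (γ'' * B₀) + γβ ≤ 5 * (d : ℝ) * L * B₈β) (β : ℝ) (len : Site d → ℝ)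
    {J : Type} (ι : J → ZdIdx d L)
    (SB9srcH : ∀ a : J, ∀ α₀ α₁ α₂ : ℝ, 0 < α₀ → α₀ ≤ cP → 0 < α₁ → 0 < α₂ → α₂ ≤ cP →
      ∀ (U₀ W : Site d → Fin d → 𝔸ˣ), (∀ x κ, U₀ x κ ∈ unitaryUnits 𝔸) → (∀ x κ, W x κ ∈ unitaryUnits 𝔸) →
      ∀ f : Site d → 𝔸, InR138 L (ι a).k (ι a).η ((ι a).Ω 0) ((ι a).Λs (ι a).k) U₀ f →
      (∀ x, IsSelfAdjoint (f x)) → (∀ x, x ∉ (ι a).Ω 0 → f x = 0) →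
      Bdd L (ι a).k (ι a).η (-(2 : ℝ)) (fun j (x : Site d) => x ∈ (ι a).Ω j) f →
      msup L (ι a).k (ι a).η (-(2 : ℝ)) (fun j (x : Site d) => x ∈ (ι a).Ω j) f < γ * (α₀ + α₁) →
      msup L (ι a).k (ι a).η (-(3 : ℝ)) (fun j (p : Fin d × Site d) => p.2 ∈ (ι a).Ω j) (fun p => covDerivFwd (ι a).η U₀ p.1 f p.2) < γ * (α₀ + α₁) →
      InAk L (ι a).k (ι a).η α₀ (ι a).Ω U₀ → InAk L (ι a).k (ι a).η α₀ (ι a).Ω (mulCfg W U₀) → IsLandau146W L (ι a).k (ι a).η ((ι a).Ω 0) ((ι a).Λs (ι a).k) U₀ f W →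
      ∀ A' : Site d → Fin d → 𝔸, (∀ y τ, IsSelfAdjoint (A' y τ)) →
      (∀ j, j ≤ (ι a).k → ∀ (y : Site d) (τ : Fin d), SideTouches ((ι a).Ω j) y τ →
        W y τ = cfgExp (ι a).η A' y τ ∧ ‖A' y τ‖ ≤ α₂ * ((L : ℝ) ^ j * (ι a).η)⁻¹) →
      (∀ (y : Site d) (τ : Fin d), (∀ j, j ≤ (ι a).k → ¬ SideTouches ((ι a).Ω j) y τ) → A' y τ = 0) →
      msup L (ι a).k (ι a).η (-(1 : ℝ)) (fun j (b : Site d × Fin d) => SideTouches ((ι a).Ω j) b.1 b.2) (fun b => A' b.1 b.2)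
          ≤ B₀ * (bondNorm L (ι a).k (ι a).η (-(3 : ℝ)) (ι a).Ω (fun x μ => Jcur (ι a).η U₀ A' μ x)
            + wsup 1 (fun p : {p : ℕ × (Site d × Fin d) // p.1 ≤ (ι a).k ∧ p.2 ∈ (ι a).Λb (ι a).k p.1} =>
                linCovIter L U₀ (iEta (ι a).η A') p.1.1 p.1.2.1 p.1.2.2)) + γ'' * B₀ * (α₀ + α₁) ∧
        msup L (ι a).k (ι a).η (-(2 : ℝ)) (fun j (t : Fin d × Fin d × Site d) => SideTouches ((ι a).Ω j) t.2.2 t.2.1)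
            (fun t => covDerivFwd (ι a).η U₀ t.1 (fun z => A' z t.2.1) t.2.2)
          ≤ B₀ * (bondNorm L (ι a).k (ι a).η (-(3 : ℝ)) (ι a).Ω (fun x μ => Jcur (ι a).η U₀ A' μ x)
            + wsup 1 (fun p : {p : ℕ × (Site d × Fin d) // p.1 ≤ (ι a).k ∧ p.2 ∈ (ι a).Λb (ι a).k p.1} =>
                linCovIter L U₀ (iEta (ι a).η A') p.1.1 p.1.2.1 p.1.2.2)) + γ'' * B₀ * (α₀ + α₁) ∧
        bondNorm L (ι a).k (ι a).η (-(3 : ℝ)) (ι a).Ω (fun x μ => pdiv (ι a).η U₀ (plaqCovDeriv (ι a).η U₀ A') μ x)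
          ≤ B₀ * (bondNorm L (ι a).k (ι a).η (-(3 : ℝ)) (ι a).Ω (fun x μ => Jcur (ι a).η U₀ A' μ x)
            + wsup 1 (fun p : {p : ℕ × (Site d × Fin d) // p.1 ≤ (ι a).k ∧ p.2 ∈ (ι a).Λb (ι a).k p.1} =>
                linCovIter L U₀ (iEta (ι a).η A') p.1.1 p.1.2.1 p.1.2.2)) + γ'' * B₀ * (α₀ + α₁) ∧
        bondNorm L (ι a).k (ι a).η (-(3 : ℝ)) (ι a).Ω (fun x μ => covLap (ι a).η U₀ (fun z => A' z μ) x)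
          ≤ B₀ * (bondNorm L (ι a).k (ι a).η (-(3 : ℝ)) (ι a).Ω (fun x μ => Jcur (ι a).η U₀ A' μ x)
            + wsup 1 (fun p : {p : ℕ × (Site d × Fin d) // p.1 ≤ (ι a).k ∧ p.2 ∈ (ι a).Λb (ι a).k p.1} =>
                linCovIter L U₀ (iEta (ι a).η A') p.1.1 p.1.2.1 p.1.2.2)) + γ'' * B₀ * (α₀ + α₁) ∧
        msup L (ι a).k (ι a).η (-(2 + β)) (fun j (q : Fin d × Fin d × (Site d × Site d)) => q.2.2 ∈ AdmPair (ι a).η len ∧ q.2.2.1 ∈ (ι a).Ω j)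
            (fun q => hquot (ι a).η β len U₀ (covDerivFwd (ι a).η U₀ q.1 (fun z => A' z q.2.1)) q.2.2)
          ≤ B₀β * (bondNorm L (ι a).k (ι a).η (-(3 : ℝ)) (ι a).Ω (fun x μ => Jcur (ι a).η U₀ A' μ x)
            + wsup 1 (fun p : {p : ℕ × (Site d × Fin d) // p.1 ≤ (ι a).k ∧ p.2 ∈ (ι a).Λb (ι a).k p.1} =>
                linCovIter L U₀ (iEta (ι a).η A') p.1.1 p.1.2.1 p.1.2.2)) + γβ * (α₀ + α₁)) :
    ∃ c : ℝ, 0 < c ∧ ∀ a : J, ∀ α₀ α₁ α₂ : ℝ, 0 < α₀ → α₀ ≤ c → 0 < α₁ → α₁ ≤ c → 0 < α₂ → α₂ ≤ c →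
      2 * α₂ ^ 2 + 20 * d * α₀ * α₂ + 2 * (2097152 * ((d : ℝ) + 1) ^ 2) * α₂ ^ 2 ≤ α₀ + α₁ →
      ∀ (U₀ : (zdGF3H 𝔸 L β len (ι a)).Cfg) (P' : (zdGF3H 𝔸 L β len (ι a)).Pert) (f : Site d → 𝔸),
        (zdGF3H 𝔸 L β len (ι a)).InR U₀ f → (zdGF3H 𝔸 L β len (ι a)).fNorm f < γ * (α₀ + α₁) → (zdGF3H 𝔸 L β len (ι a)).fGrad U₀ f < γ * (α₀ + α₁) →
        (zdGF3H 𝔸 L β len (ι a)).InA α₀ U₀ → (zdGF3H 𝔸 L β len (ι a)).InAPair α₀ U₀ P' → (zdGF3H 𝔸 L β len (ι a)).C162 1 α₂ U₀ P' →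
        (zdGF3H 𝔸 L β len (ι a)).LandauF U₀ f P' → (zdGF3H 𝔸 L β len (ι a)).C137 α₁ U₀ P' →
        (zdGF3H 𝔸 L β len (ι a)).C136 (5 * d * L * B₈) (5 * d * L * B₈β) (α₀ + α₁) U₀ P' ∧
          (zdGF3H 𝔸 L β len (ι a)).C139 (5 * d * L * B₈) (α₀ + α₁) U₀ P' := by
  have hL1 : 1 ≤ L := le_trans (by norm_num) hL
  have hLr : (1 : ℝ) ≤ L := by exact_mod_cast hL1
  have hB₀' : 0 ≤ B₀ := hB₀.le
  obtain ⟨cN, hcN, hwin⟩ := prop3_windows hd2 hL hB₀'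
  refine ⟨min cP cN, lt_min hcP hcN, ?_⟩
  intro a α₀ α₁ α₂ hα₀ hα₀c hα₁ _ hα₂ hα₂c h61 U₀ P f hInR hfN hfG hInA hPair h162 hLan h137
  have hα₀P : α₀ ≤ cP := hα₀c.trans (min_le_left _ _)
  have hα₂P : α₂ ≤ cP := hα₂c.trans (min_le_left _ _)
  obtain ⟨hα3, hα4, h16, hd5, hsmall, hc₃, hside, h50, hC⟩ :=
    hwin α₀ α₂ hα₀ (hα₀c.trans (min_le_right _ _)) hα₂.le (hα₂c.trans (min_le_right _ _))
  have hC₂' : 8 * (131072 * ((d : ℝ) + 1) ^ 2) * Real.exp (4 * (800 * ((d : ℝ) + 1) ^ 2 * ((d : ℝ) + 4)) * α₀) ≤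
      2097152 * ((d : ℝ) + 1) ^ 2 := hC
  have hS0 : 0 ≤ α₀ + α₁ := by linarith
  have hT0 : 0 ≤ γ'' * B₀ * (α₀ + α₁) := by positivity
  -- the data
  set W : Site d → Fin d → 𝔸ˣ := P.2.1 with hW_def
  have hWu : ∀ x κ, W x κ ∈ unitaryUnits 𝔸 := P.2.2
  have hU₀ : ∀ x κ, U₀.1 x κ ∈ unitaryUnits 𝔸 := U₀.2
  set A : Site d → Fin d → 𝔸 := mlogCfg (ι a).k (ι a).η (ι a).Ω W with hA_def
  -- (1.41) and self-adjointness of the canonical exponent; `W = e^{iηA}` on the `E j`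
  have h41 : ∀ j, j ≤ (ι a).k → ∀ (y : Site d) (τ : Fin d), SideTouches ((ι a).Ω j) y τ →
      W y τ = cfgExp (ι a).η A y τ ∧ ‖A y τ‖ ≤ α₂ * ((L : ℝ) ^ j * (ι a).η)⁻¹ := by
    intro j hj y τ hs
    obtain ⟨hexp, -, hbd⟩ := h162 j hj (y, τ) hs
    have hexp' : W y τ = cfgExp (ι a).η (logCfg (ι a).η W) y τ := hexp
    have hbd' : ‖logCfg (ι a).η W y τ‖ ≤ 1 * α₂ * ((L : ℝ) ^ j * (ι a).η)⁻¹ := hbd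
    have hAy : A y τ = logCfg (ι a).η W y τ := mlogCfg_of_sideTouches (ι a).η W hj hs
    refine ⟨?_, ?_⟩
    · rw [hexp']
      exact cfgExp_congr_at (ι a).η hAy.symm
    · rw [hAy]
      simpa only [one_mul] using hbd'
  have hAsa : ∀ y τ, IsSelfAdjoint (A y τ) := by
    intro y τ
    by_cases hmem : ∃ j, j ≤ (ι a).k ∧ SideTouches ((ι a).Ω j) y τ
    · obtain ⟨j, hj, hs⟩ := hmem
      rw [hA_def, mlogCfg_of_sideTouches (ι a).η W hj hs]
      exact (h162 j hj (y, τ) hs).2.1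
    · rw [hA_def, mlogCfg_of_not (ι a).η W fun j hj hs => hmem ⟨j, hj, hs⟩]
      exact IsSelfAdjoint.zero 𝔸
  have hA0 : ∀ (y : Site d) (τ : Fin d), (∀ j, j ≤ (ι a).k → ¬ SideTouches ((ι a).Ω j) y τ) → A y τ = 0 :=
    fun y τ h => mlogCfg_of_not (ι a).η W h
  -- (1.40)₁ for `e^{iηA}U₀` by locality; the Landau clause for `e^{iηA}` by locality
  have h40₁ : InAk L (ι a).k (ι a).η α₀ (ι a).Ω (mulCfg (expCfg (iEta (ι a).η A)) U₀.1) := by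
    refine (inAk_congr_of_sideTouches L (ι a).k (ι a).η α₀ (V := mulCfg W U₀.1) fun j hj y τ hs => ?_).1 hPair
    show W y τ * U₀.1 y τ = expCfg (iEta (ι a).η A) y τ * U₀.1 y τ
    rw [(h41 j hj y τ hs).1, expCfg_iEta_eq_cfgExp]
  -- the global bound and the gradient datum (bounded family)
  have hAglob : ∀ y τ, ‖A y τ‖ ≤ α₂ * (ι a).η⁻¹ := by
    intro y τ
    by_cases hmem : ∃ j, j ≤ (ι a).k ∧ SideTouches ((ι a).Ω j) y τ
    · obtain ⟨j, hj, hs⟩ := hmem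
      have hLj : (1 : ℝ) ≤ (L : ℝ) ^ j := one_le_pow₀ hLr
      have hη0 : 0 < (ι a).η := (ι a).hη
      calc ‖A y τ‖ ≤ α₂ * ((L : ℝ) ^ j * (ι a).η)⁻¹ := (h41 j hj y τ hs).2
        _ = α₂ * (ι a).η⁻¹ * ((L : ℝ) ^ j)⁻¹ := by rw [mul_inv]; ring
        _ ≤ α₂ * (ι a).η⁻¹ * 1 := by
            apply mul_le_mul_of_nonneg_left (inv_le_one_of_one_le₀ hLj) (by positivity)
        _ = α₂ * (ι a).η⁻¹ := mul_one _
    · rw [hA0 y τ fun j hj hs => hmem ⟨j, hj, hs⟩, norm_zero]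
      have hη0 : 0 < (ι a).η := (ι a).hη
      positivity
  have hU₀1 : ∀ x κ, U₀.1 x κ ∈ U1 𝔸 := fun x κ => unitaryUnits_le_U1 (hU₀ x κ)
  have hgrad : ∀ (y : Site d) (κ τ : Fin d), ‖covDerivFwd (ι a).η U₀.1 κ (fun z => A z τ) y‖ ≤ 2 * α₂ * (ι a).η⁻¹ * (ι a).η⁻¹ := by
    intro y κ τ
    have hη0 : 0 < (ι a).η := (ι a).hη
    unfold covDerivFwd
    rw [norm_smul, norm_inv, Real.norm_eq_abs, abs_of_pos hη0]
    have h1 : ‖B7Eq78Linearization.conjR (U₀.1 y κ) (A (y + e κ) τ) - A y τ‖ ≤ α₂ * (ι a).η⁻¹ + α₂ * (ι a).η⁻¹ := by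
      calc ‖B7Eq78Linearization.conjR (U₀.1 y κ) (A (y + e κ) τ) - A y τ‖
          ≤ ‖B7Eq78Linearization.conjR (U₀.1 y κ) (A (y + e κ) τ)‖ + ‖A y τ‖ := norm_sub_le _ _
        _ ≤ α₂ * (ι a).η⁻¹ + α₂ * (ι a).η⁻¹ := by
            rw [B8Ineq132.norm_conjR (hU₀1 y κ)]
            exact add_le_add (hAglob _ _) (hAglob _ _)
    calc (ι a).η⁻¹ * ‖B7Eq78Linearization.conjR (U₀.1 y κ) (A (y + e κ) τ) - A y τ‖ ≤ (ι a).η⁻¹ * (α₂ * (ι a).η⁻¹ + α₂ * (ι a).η⁻¹) :=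
        mul_le_mul_of_nonneg_left h1 (by positivity)
      _ = 2 * α₂ * (ι a).η⁻¹ * (ι a).η⁻¹ := by ring
  have hBg : Bdd L (ι a).k (ι a).η (-(2 : ℝ)) (fun j (t : Fin d × Fin d × Site d) => SideTouches ((ι a).Ω j) t.2.2 t.2.1)
      (fun t => covDerivFwd (ι a).η U₀.1 t.1 (fun z => A z t.2.1) t.2.2) := by
    have e2 : (-(2 : ℝ)) = -((2 : ℕ) : ℝ) := by norm_num
    rw [e2]
    refine B8ScaledSupNorm.bdd_of_forall (c := 2 * α₂ * ((L : ℝ) ^ (ι a).k) ^ 2) fun j hj t _ => ?_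
    rw [B8ScaledSupNorm.weight_neg_natCast L (ι a).η 2 j]
    have hLjk : (L : ℝ) ^ j ≤ (L : ℝ) ^ (ι a).k := pow_le_pow_right₀ hLr hj
    have hLj0 : (0 : ℝ) ≤ (L : ℝ) ^ j := by positivity
    have hη0 : 0 < (ι a).η := (ι a).hη
    calc ((L : ℝ) ^ j * (ι a).η) ^ 2 * ‖covDerivFwd (ι a).η U₀.1 t.1 (fun z => A z t.2.1) t.2.2‖
        ≤ ((L : ℝ) ^ j * (ι a).η) ^ 2 * (2 * α₂ * (ι a).η⁻¹ * (ι a).η⁻¹) := mul_le_mul_of_nonneg_left (hgrad _ _ _) (by positivity)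
      _ = 2 * α₂ * ((L : ℝ) ^ j) ^ 2 := by field_simp
      _ ≤ 2 * α₂ * ((L : ℝ) ^ (ι a).k) ^ 2 := by gcongr
  set g : ℝ := msup L (ι a).k (ι a).η (-(2 : ℝ)) (fun j (t : Fin d × Fin d × Site d) => SideTouches ((ι a).Ω j) t.2.2 t.2.1)
      (fun t => covDerivFwd (ι a).η U₀.1 t.1 (fun z => A z t.2.1) t.2.2) with hg_def
  have hg0 : 0 ≤ g := B8ScaledSupNorm.msup_nonneg L (ι a).k (ι a).hη.le _ _ _
  have hg : ∀ j, j ≤ (ι a).k → ∀ (y : Site d) (κ τ : Fin d), SideTouches ((ι a).Ω j) y τ →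
      ((L : ℝ) ^ j * (ι a).η) ^ 2 * ‖covDerivFwd (ι a).η U₀.1 κ (fun z => A z τ) y‖ ≤ g := by
    intro j hj y κ τ hs
    have h := B8ScaledSupNorm.weight_mul_norm_le_msup hBg hj (i := (κ, τ, y)) hs
    have hw : weight L (ι a).η (-(2 : ℝ)) j = ((L : ℝ) ^ j * (ι a).η) ^ 2 := by
      have e2 : (-(2 : ℝ)) = -((2 : ℕ) : ℝ) := by norm_num
      rw [e2, B8ScaledSupNorm.weight_neg_natCast L (ι a).η 2 j]
    rw [hw] at h
    exact h
  -- the Landau clause for `e^{iηA}` and the in-edge (1.59), five lines, from the socket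
  have hLanA : IsLandau146W L (ι a).k (ι a).η ((ι a).Ω 0) ((ι a).Λs (ι a).k) U₀.1 f W := hLan
  obtain ⟨h59a, h59g, h59j, h59l, h59h⟩ := SB9srcH a α₀ α₁ α₂ hα₀ hα₀P hα₁ hα₂ hα₂P U₀.1 W hU₀ hWu f hInR.1 hInR.2.1 hInR.2.2.1 hInR.2.2.2 hfN hfG hInA hPair hLanA A
    hAsa h41 hA0
  -- (1.42) = the member's (1.37) clause, on the classified constraint bonds of the top truncation
  have hbox : ∀ j, j ≤ (ι a).k → ∀ c ∈ (ι a).Λb (ι a).k j, ∀ x, InBox (loK L j c.1) (bondHiK L j c.1 c.2) x → x ∈ (ι a).Ω j :=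
    fun j hj c hc x hx => (ι a).hbox (ι a).k le_rfl j hj c hc x hx
  have h42 : ∀ j, j ≤ (ι a).k → ∀ c ∈ (ι a).Λb (ι a).k j, ‖logCovIter L U₀.1 (iEta (ι a).η A) j c.1 c.2‖ < 2 * d * L * α₁ := h137
  have h41' : ∀ j, j ≤ (ι a).k → ∀ (y : Site d) (τ : Fin d), SideTouches ((ι a).Ω j) y τ → ‖A y τ‖ ≤ α₂ * ((L : ℝ) ^ j * (ι a).η)⁻¹ :=
    fun j hj y τ hs => (h41 j hj y τ hs).2
  -- PROPOSITION 3 at `k` levels (n05-b), all four members, and the Hölder member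
  obtain ⟨ha, hg', hj, hl⟩ := prop3_norms_kLevel_src4 hd2 (ι a).hη hL hU₀ hAsa hα₀ hα₁.le hα₂.le hg0 hα3 hα4 h16 hd5
    hsmall hc₃ hB₀' hside h50 hC₂' h61 hbox hInA h40₁ h41' hg h42 h59a h59g h59j h59l
  have hh := prop3_fifth_kLevel_src hd2 (ι a).hη hL hU₀ hAsa hα₀ hα₁.le hα₂.le hg0 hα3 hα4 h16 hd5 hsmall hc₃ hB₀' hB₀β
    hside h50 hC₂' h61 hbox hInA h40₁ h41' hg h42 hT0 h59g h59h
  -- the enlarged constants absorb the source terms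
  have hc8 : 5 * (d : ℝ) * L * B₀ * (α₀ + α₁) + (γ'' * B₀ * (α₀ + α₁) + γ'' * B₀ * (α₀ + α₁)) ≤ 5 * (d : ℝ) * L * B₈ * (α₀ + α₁) := by
    have h := mul_le_mul_of_nonneg_right hB8 hS0
    calc 5 * (d : ℝ) * L * B₀ * (α₀ + α₁) + (γ'' * B₀ * (α₀ + α₁) + γ'' * B₀ * (α₀ + α₁))
        = (5 * (d : ℝ) * L * B₀ + 2 * (γ'' * B₀)) * (α₀ + α₁) := by ring
      _ ≤ 5 * (d : ℝ) * L * B₈ * (α₀ + α₁) := h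
  have hc8β : 5 * (d : ℝ) * L * B₀β * (α₀ + α₁) + (2 * B₀β * (γ'' * B₀ * (α₀ + α₁)) + γβ * (α₀ + α₁)) ≤
      5 * (d : ℝ) * L * B₈β * (α₀ + α₁) := by
    have h := mul_le_mul_of_nonneg_right hB8β hS0
    calc 5 * (d : ℝ) * L * B₀β * (α₀ + α₁) + (2 * B₀β * (γ'' * B₀ * (α₀ + α₁)) + γβ * (α₀ + α₁))
        = (5 * (d : ℝ) * L * B₀β + 2 * B₀β * (γ'' * B₀) + γβ) * (α₀ + α₁) := by ring
      _ ≤ 5 * (d : ℝ) * L * B₈β * (α₀ + α₁) := h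
  have ha' : msup L (ι a).k (ι a).η (-(1 : ℝ)) (fun j (b : Site d × Fin d) => SideTouches ((ι a).Ω j) b.1 b.2) (fun b => A b.1 b.2) ≤
      5 * (d : ℝ) * L * B₈ * (α₀ + α₁) := ha.trans hc8
  refine ⟨⟨fun j hj b hb => ?_, hg'.trans (by linarith [hc8]), hh.trans hc8β⟩, hj.trans hc8, hl.trans hc8⟩
  -- (1.36)₁ pointwise on the `E j`, read on the logarithm
  obtain ⟨hexp, hsa, -⟩ := h162 j hj b hb
  refine ⟨hexp, hsa, ?_⟩
  have hpt := B8Thm2GaugeFixedKLevel.thm2_pointwise_A (ι a).hη hL1 h41' ha' hj (y := b.1) (τ := b.2) hb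
  rw [← mlogCfg_of_sideTouches (ι a).η W hj hb]
  exact hpt

end Zd3H

#print axioms sp3src_zd3H_map_of_sockB9P3srcH

end Literature.MathematicalPhysics.QuantumFieldTheory.Balaban1983to89.B8Prop3SrcZd3H

end
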